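/-
COR-CM (cell pub-hodgecm2, stage 2 of the Hodge ladder) — count-neutral KERNEL COMBINATORICS «the sheared dihedral family», part XX: the closing lattice
of the slice column — the finite check and the conclusion (seat prover-pub-hodgecm2-b23-g52-0, binder prover b23, gen 52; claim «SYLOW TRANSFER XII +
THE SHEARED DIHEDRAL FAMILY», HOME/INBOX.md l.23708).  PORT of gen 44ʼs `Census/QuarticInversionLattice.lean` (this lineage) to the involution `s`
at square class `0`: bookkeeping definitions with bodies (the integer tables `GkS`, `GCvS`, `muS`) + theorems, on parts XII/XVIII/XIX and gen 44ʼs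
parts XIX/XX (`Bk`, `BCv`, `tab16`, `funext_pat`, `kC_decomp`, `ΨL`, the relation lemmas) BY NAME; `decide` only on closed identities between
literal integer tables over `Fin 4`, `Fin 8`, `Fin 12`, `Fin 16` and on closed values at literal patterns (the finite index-one check; the tables
were produced by this folderʼs `work/gen52/l8_s.py` + `lattice_s.py`, adapted from gen 44ʼs `l8.py`/`lattice.py`, and are re-checked here by the
kernel), no certificate, no named fact, no geometry, no `sorry`.  `Interfaces.lean` (C1), every E term, B01, `Transposition/*`, `PortJoin/*`,
`D2Bridge/*` untouched.
HONEST FRAMING: `HC_CM` is NOT proved, here or anywhere in the tree; nothing here is a period, a count of record or a headline.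
-/
import Summits.HodgeConjecture.CorCM.Census.ShearedDihedralGenerators
import Summits.HodgeConjecture.CorCM.Census.ShearedDihedralTrees
import Summits.HodgeConjecture.CorCM.Census.QuarticInversionLattice

/-!
# The sheared dihedral family, XX: the closing lattice of the slice column

CONTENT (`|A|` odd `≥ 3`, square class `0`, a slot datum `(P,u₁,u₂;Q,w,u₀)` and a cross datum `(σ,s₀)` as in part XVIII).
* §1 **The finite check**: every basis vector `B_l` of the relation lattice (gen 44 part XIX) is an explicit integer combination of the tables of
  the twelve normal forms of `g·S_b` (`g ∈ {e, y, s, sy}`, `b ∈ {TTT, TTF, TFT}`; `B_eq_sum_GS`), and these tables ARE the normal forms of part XIX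
  and gen 44ʼs part XVIII (`ΦL_GS_mem`: so they lie in the value module of `B1`).
* §2 **CONCLUSION**: for every Hodge vector `x`, `nf x` and hence `Avec x` lie in the value module `valModS A 0 B1` (`nf_mem_valModS_of_hodge`,
  `Avec_mem_valModS_of_hodge`).  All [folklore].

## References
* [Pohlmann1968] H. Pohlmann, Algebraic cycles on abelian varieties of complex multiplication type, Ann. of Math. 88 (1968), Thm 1.
-/

namespace Summit.HodgeConjecture.CorCM.Census.ShearedDihedral

open Summit.HodgeConjecture.CorCM.Census.QuarticInversion
open Finset
open Summit.HodgeConjecture.CorCM.Census.OddSliceFacesModel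

noncomputable section

/-! ## §1 The generator tables and the finite check -/

/-- The column parts of the twelve generator normal forms (order `b ∈ (TTT, TTF, TFT)` × `(e, y, s, sy)`, square class `0`). [folklore] -/
def GkS : Fin 12 → Fin 4 → ℤ := ![![1, 0, 0, 0], ![0, 1, 0, 0], ![0, 0, 1, 0], ![0, 0, 0, -1], ![1, 0, 0, 0], ![0, 1, 0, 0], ![0, 0, 1, 0], ![0, 0, 0, -1], ![1, 0, 0, 0], ![0, 1, 0, 0], ![0, 0, 1, 0], ![0, 0, 0, -1]]

/-- The constant parts (as tables) of the twelve generator normal forms. [folklore] -/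
def GCvS : Fin 12 → Fin 16 → ℤ := ![![1, 0, 0, 0, 0, 0, 0, 1, -1, 0, 0, 0, 0, 0, 0, -1],
  ![1, 0, 0, 0, -1, 0, 0, 0, 0, 0, 0, 1, 0, 0, 0, -1],
  ![0, 0, 0, 0, 0, 1, 0, -1, 1, 0, -1, 0, 0, 0, 0, 0],
  ![0, 0, 0, 0, -1, 1, 0, 0, 0, 0, -1, 1, 0, 0, 0, 0],
  ![0, 1, 0, 0, 0, 0, 1, 0, 0, -1, 0, 0, 0, 0, -1, 0],
  ![0, 0, 1, 0, 0, 0, -1, 0, 0, 1, 0, 0, 0, -1, 0, 0],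
  ![0, 1, 0, -1, 0, 0, 0, 0, 0, 0, 0, 0, 1, 0, -1, 0],
  ![0, 0, -1, 1, 0, 0, 0, 0, 0, 0, 0, 0, -1, 1, 0, 0],
  ![0, 0, 1, 0, 0, 1, 0, 0, 0, 0, -1, 0, 0, -1, 0, 0],
  ![0, 1, 0, 0, 0, -1, 0, 0, 0, 0, 1, 0, 0, 0, -1, 0],
  ![1, 0, -1, 0, 0, 0, 0, 0, 0, 0, 0, 0, 0, 1, 0, -1],
  ![-1, 1, 0, 0, 0, 0, 0, 0, 0, 0, 0, 0, 0, 0, -1, 1]]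

/-- The integer coefficients expressing the basis vectors through the generators. [folklore] -/
def muS : Fin 8 → Fin 12 → ℤ := ![![0, 0, 1, 0, 1, 0, -1, 0, 0, 0, 0, 0],
  ![0, 0, 1, 0, 1, 1, -1, 0, -1, 0, 0, 0],
  ![0, 0, 1, 0, 0, 0, 0, 0, 0, 0, 0, 0],
  ![-1, 1, 0, -1, 0, -1, 0, 0, 1, 0, 0, 0],
  ![-1, 0, 1, 0, 1, 0, -1, 0, 0, 0, 0, 0],
  ![0, 0, 1, 0, 0, 0, -1, 0, 0, 0, 0, 0],
  ![0, 0, 1, 0, 1, 0, -1, 0, -1, 0, 0, 0],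
  ![-1, 1, 0, 0, 0, -1, 0, 0, 1, 0, 0, 0]]

/-- **The finite check**: every basis vector of the relation lattice is an integer combination of the generator normal forms. [folklore] -/
theorem B_eq_sum_GS (l : Fin 8) : ((Bk l, BCv l) : (Fin 4 → ℤ) × (Fin 16 → ℤ)) = ∑ i : Fin 12, muS l i • (GkS i, GCvS i) := by
  fin_cases l <;> decide

section Members
variable (A : Type) [AddCommGroup A] [Fintype A] [DecidableEq A]
variable {P : Finset A} {u₁ u₂ : A} {Q : Finset A} {w u₀ σ s₀ : A}

omit [AddCommGroup A] in
/-- `B1` consists of Hodge vectors. [folklore] -/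
theorem famB1S_subset_hodge₄ (h12 : u₁ ≠ u₂) : (↑(famB1S A P u₁ u₂ Q w u₀) : Set (Ty₄ A → ℤ)) ⊆ hodge₄ A := by
  intro f hf
  obtain ⟨k, -, rfl⟩ := Finset.mem_image.mp (Finset.mem_coe.mp hf)
  have hne : ((0 : Fin 4), u₁) ≠ ((0 : Fin 4), u₂) := fun e => h12 (Prod.mk.inj e).2
  have hne1 : ∀ u u' : A, ((0 : Fin 4), u) ≠ ((1 : Fin 4), u') := fun u u' e => absurd (Prod.mk.inj e).1 (by decide)
  have hne2 : ∀ u u' : A, ((0 : Fin 4), u) ≠ ((2 : Fin 4), u') := fun u u' e => absurd (Prod.mk.inj e).1 (by decide)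
  fin_cases k
  · exact faceVec₄_mem A _ hne
  · exact faceVec₄_mem A _ hne
  · exact faceVec₄_mem A _ hne
  · exact faceVec₄_mem A _ hne
  · exact faceVec₄_mem A _ hne
  · exact faceVec₄_mem A _ (hne1 _ _)
  · exact faceVec₄_mem A _ (hne2 _ _)
  · exact faceVec₄_mem A _ (hne1 _ _)
  · exact faceVec₄_mem A _ (hne1 _ _)
  · exact faceVec₄_mem A _ (hne1 _ _)

/-- **Every generator normal form lies in the value module of `B1`** (square class `0`). [folklore] -/
theorem ΦL_GS_mem (hA : Odd (Fintype.card A)) (h3 : 3 ≤ Fintype.card A) (h1 : u₁ ∉ P) (h2 : u₂ ∉ P) (h12 : u₁ ≠ u₂)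
    (hP : P.card + 1 = Fintype.card A / 2) (hs₀ : s₀ ∈ insert u₁ (insert u₂ P))
    (hX : ∀ s, s + σ ∈ insert u₁ (insert u₂ P) ↔ (s ∉ insert u₁ (insert u₂ P) ∨ s = s₀)) (hw : w ∉ Q)
    (hQ : Q.card = Fintype.card A / 2) (i : Fin 12) :
    ΨL A (GkS i, GCvS i) ∈ valModS A 0 ↑(famB1S A P u₁ u₂ Q w u₀) := by
  have hF := famB1S_subset_hodge₄ A (P := P) (Q := Q) (w := w) (u₀ := u₀) h12
  have hbin := all_binS A hA h3 h1 h2 h12 hP hs₀ hX hw hQ (u₀ := u₀)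
  have mTTT := subset_orbSpanS A 0 _ (mem_S_TTT A P u₁ u₂ Q w u₀)
  have mTTF := subset_orbSpanS A 0 _ (mem_S_TTF A P u₁ u₂ Q w u₀)
  have mTFT := subset_orbSpanS A 0 _ (mem_S_TFT A P u₁ u₂ Q w u₀)
  fin_cases i
  · show ΨL A (GkS 0, GCvS 0) ∈ _
    have e : ((GkS 0, tab16 (GCvS 0)) : (Fin 4 → ℤ) × ((Fin 4 → Bool) → ℤ)) = (kS, cB ![false, true, true, true]) :=
      Prod.ext (by decide) (funext_pat fun a b c d => by cases a <;> cases b <;> cases c <;> cases d <;> decide)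
    have h := nf_mem_of_binS A hA 0 hF hbin mTTT
    rw [nf_S A hA h1 h2 h12 hP ![false, true, true, true]] at h
    rw [ΨL_apply, e]; exact h
  · show ΨL A (GkS 1, GCvS 1) ∈ _
    have e : ((GkS 1, tab16 (GCvS 1)) : (Fin 4 → ℤ) × ((Fin 4 → Bool) → ℤ)) = (kY 0, fun η => cB ![false, true, true, true] (pY 0 η)) :=
      Prod.ext (by decide) (funext_pat fun a b c d => by cases a <;> cases b <;> cases c <;> cases d <;> decide)
    have h := nf_mem_of_binS A hA 0 hF hbin (translY_mem_orbSpanS A 0 _ mTTT)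
    rw [nf_yS A hA 0 h1 h2 h12 hP ![false, true, true, true]] at h
    rw [ΨL_apply, e]; exact h
  · show ΨL A (GkS 2, GCvS 2) ∈ _
    have e : ((GkS 2, tab16 (GCvS 2)) : (Fin 4 → ℤ) × ((Fin 4 → Bool) → ℤ)) = (kSh, fun η => cB ![false, true, true, true] (pS η)) :=
      Prod.ext (by decide) (funext_pat fun a b c d => by cases a <;> cases b <;> cases c <;> cases d <;> decide)
    have h := nf_mem_of_binS A hA 0 hF hbin (translS_mem_orbSpanS A 0 _ mTTT)
    rw [nf_sS A hA h1 h2 h12 hP ![false, true, true, true]] at h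
    rw [ΨL_apply, e]; exact h
  · show ΨL A (GkS 3, GCvS 3) ∈ _
    have e : ((GkS 3, tab16 (GCvS 3)) : (Fin 4 → ℤ) × ((Fin 4 → Bool) → ℤ)) = (kShY 0, fun η => cB ![false, true, true, true] (pY 0 (pS η))) :=
      Prod.ext (by decide) (funext_pat fun a b c d => by cases a <;> cases b <;> cases c <;> cases d <;> decide)
    have h := nf_mem_of_binS A hA 0 hF hbin (translS_mem_orbSpanS A 0 _ (translY_mem_orbSpanS A 0 _ mTTT))
    rw [nf_syS A hA 0 h1 h2 h12 hP ![false, true, true, true]] at h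
    rw [ΨL_apply, e]; exact h
  · show ΨL A (GkS 4, GCvS 4) ∈ _
    have e : ((GkS 4, tab16 (GCvS 4)) : (Fin 4 → ℤ) × ((Fin 4 → Bool) → ℤ)) = (kS, cB ![false, true, true, false]) :=
      Prod.ext (by decide) (funext_pat fun a b c d => by cases a <;> cases b <;> cases c <;> cases d <;> decide)
    have h := nf_mem_of_binS A hA 0 hF hbin mTTF
    rw [nf_S A hA h1 h2 h12 hP ![false, true, true, false]] at h
    rw [ΨL_apply, e]; exact h
  · show ΨL A (GkS 5, GCvS 5) ∈ _
    have e : ((GkS 5, tab16 (GCvS 5)) : (Fin 4 → ℤ) × ((Fin 4 → Bool) → ℤ)) = (kY 0, fun η => cB ![false, true, true, false] (pY 0 η)) :=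
      Prod.ext (by decide) (funext_pat fun a b c d => by cases a <;> cases b <;> cases c <;> cases d <;> decide)
    have h := nf_mem_of_binS A hA 0 hF hbin (translY_mem_orbSpanS A 0 _ mTTF)
    rw [nf_yS A hA 0 h1 h2 h12 hP ![false, true, true, false]] at h
    rw [ΨL_apply, e]; exact h
  · show ΨL A (GkS 6, GCvS 6) ∈ _
    have e : ((GkS 6, tab16 (GCvS 6)) : (Fin 4 → ℤ) × ((Fin 4 → Bool) → ℤ)) = (kSh, fun η => cB ![false, true, true, false] (pS η)) :=
      Prod.ext (by decide) (funext_pat fun a b c d => by cases a <;> cases b <;> cases c <;> cases d <;> decide)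
    have h := nf_mem_of_binS A hA 0 hF hbin (translS_mem_orbSpanS A 0 _ mTTF)
    rw [nf_sS A hA h1 h2 h12 hP ![false, true, true, false]] at h
    rw [ΨL_apply, e]; exact h
  · show ΨL A (GkS 7, GCvS 7) ∈ _
    have e : ((GkS 7, tab16 (GCvS 7)) : (Fin 4 → ℤ) × ((Fin 4 → Bool) → ℤ)) = (kShY 0, fun η => cB ![false, true, true, false] (pY 0 (pS η))) :=
      Prod.ext (by decide) (funext_pat fun a b c d => by cases a <;> cases b <;> cases c <;> cases d <;> decide)
    have h := nf_mem_of_binS A hA 0 hF hbin (translS_mem_orbSpanS A 0 _ (translY_mem_orbSpanS A 0 _ mTTF))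
    rw [nf_syS A hA 0 h1 h2 h12 hP ![false, true, true, false]] at h
    rw [ΨL_apply, e]; exact h
  · show ΨL A (GkS 8, GCvS 8) ∈ _
    have e : ((GkS 8, tab16 (GCvS 8)) : (Fin 4 → ℤ) × ((Fin 4 → Bool) → ℤ)) = (kS, cB ![false, true, false, true]) :=
      Prod.ext (by decide) (funext_pat fun a b c d => by cases a <;> cases b <;> cases c <;> cases d <;> decide)
    have h := nf_mem_of_binS A hA 0 hF hbin mTFT
    rw [nf_S A hA h1 h2 h12 hP ![false, true, false, true]] at h
    rw [ΨL_apply, e]; exact h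
  · show ΨL A (GkS 9, GCvS 9) ∈ _
    have e : ((GkS 9, tab16 (GCvS 9)) : (Fin 4 → ℤ) × ((Fin 4 → Bool) → ℤ)) = (kY 0, fun η => cB ![false, true, false, true] (pY 0 η)) :=
      Prod.ext (by decide) (funext_pat fun a b c d => by cases a <;> cases b <;> cases c <;> cases d <;> decide)
    have h := nf_mem_of_binS A hA 0 hF hbin (translY_mem_orbSpanS A 0 _ mTFT)
    rw [nf_yS A hA 0 h1 h2 h12 hP ![false, true, false, true]] at h
    rw [ΨL_apply, e]; exact h
  · show ΨL A (GkS 10, GCvS 10) ∈ _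
    have e : ((GkS 10, tab16 (GCvS 10)) : (Fin 4 → ℤ) × ((Fin 4 → Bool) → ℤ)) = (kSh, fun η => cB ![false, true, false, true] (pS η)) :=
      Prod.ext (by decide) (funext_pat fun a b c d => by cases a <;> cases b <;> cases c <;> cases d <;> decide)
    have h := nf_mem_of_binS A hA 0 hF hbin (translS_mem_orbSpanS A 0 _ mTFT)
    rw [nf_sS A hA h1 h2 h12 hP ![false, true, false, true]] at h
    rw [ΨL_apply, e]; exact h
  · show ΨL A (GkS 11, GCvS 11) ∈ _
    have e : ((GkS 11, tab16 (GCvS 11)) : (Fin 4 → ℤ) × ((Fin 4 → Bool) → ℤ)) = (kShY 0, fun η => cB ![false, true, false, true] (pY 0 (pS η))) :=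
      Prod.ext (by decide) (funext_pat fun a b c d => by cases a <;> cases b <;> cases c <;> cases d <;> decide)
    have h := nf_mem_of_binS A hA 0 hF hbin (translS_mem_orbSpanS A 0 _ (translY_mem_orbSpanS A 0 _ mTFT))
    rw [nf_syS A hA 0 h1 h2 h12 hP ![false, true, false, true]] at h
    rw [ΨL_apply, e]; exact h

/-! ## §2 The conclusion -/

/-- **THE CLOSING LATTICE: the normal form of every Hodge vector lies in the value module of `B1`** (square class `0`). [folklore] -/
theorem nf_mem_valModS_of_hodge (hA : Odd (Fintype.card A)) (h3 : 3 ≤ Fintype.card A) (h1 : u₁ ∉ P) (h2 : u₂ ∉ P)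
    (h12 : u₁ ≠ u₂) (hP : P.card + 1 = Fintype.card A / 2) (hs₀ : s₀ ∈ insert u₁ (insert u₂ P))
    (hX : ∀ s, s + σ ∈ insert u₁ (insert u₂ P) ↔ (s ∉ insert u₁ (insert u₂ P) ∨ s = s₀)) (hw : w ∉ Q)
    (hQ : Q.card = Fintype.card A / 2) {x : Ty₄ A → ℤ} (hx : x ∈ hodge₄ A) :
    nf A x ∈ valModS A 0 ↑(famB1S A P u₁ u₂ Q w u₀) := by
  have hdec := kC_decomp (fun j => kOf A j x) (fun η => fnl A (wC A η) x) (fun η => fnl_wC_not A hA η x)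
    (rel01_lit A hA hx) (rel02_lit A hA hx) (rel03_lit A hA hx) (rel4_lit A hA hx)
  rw [nf_eq_ΦL, hdec, map_sum]
  refine Submodule.sum_mem _ fun l _ => ?_
  rw [map_smul]
  refine Submodule.smul_mem _ _ ?_
  rw [← ΨL_apply, B_eq_sum_GS l, map_sum]
  refine Submodule.sum_mem _ fun i _ => ?_
  rw [map_smul]
  exact Submodule.smul_mem _ _ (ΦL_GS_mem A hA h3 h1 h2 h12 hP hs₀ hX hw hQ i)

/-- **The value vector of every Hodge vector lies in the value module of `B1`**: `Avec x ∈ Avec (orbSpanS 0 B1)`. [folklore] -/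
theorem Avec_mem_valModS_of_hodge (hA : Odd (Fintype.card A)) (h3 : 3 ≤ Fintype.card A) (h1 : u₁ ∉ P) (h2 : u₂ ∉ P)
    (h12 : u₁ ≠ u₂) (hP : P.card + 1 = Fintype.card A / 2) (hs₀ : s₀ ∈ insert u₁ (insert u₂ P))
    (hX : ∀ s, s + σ ∈ insert u₁ (insert u₂ P) ↔ (s ∉ insert u₁ (insert u₂ P) ∨ s = s₀)) (hw : w ∉ Q)
    (hQ : Q.card = Fintype.card A / 2) {x : Ty₄ A → ℤ} (hx : x ∈ hodge₄ A) :
    Avec A x ∈ valModS A 0 ↑(famB1S A P u₁ u₂ Q w u₀) :=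
  Avec_mem_of_nf_mem A hA (all_binS A hA h3 h1 h2 h12 hP hs₀ hX hw hQ) hx
    (nf_mem_valModS_of_hodge A hA h3 h1 h2 h12 hP hs₀ hX hw hQ hx)

end Members

end

end Summit.HodgeConjecture.CorCM.Census.ShearedDihedral
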